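import Summits.QuantumFields.YangMills.Theorems.UnitScaleTiltCurvGradAxialBianchi
import Summits.QuantumFields.YangMills.Theorems.UnitScaleTiltCurvGradFlatTensor
import Literature.MathematicalPhysics.QuantumFieldTheory.Balaban1983to89.B10Eq27AxialLog
import HarnessLib

/-!
# Gauge side of the curvature-gradient bound, file 2/3: in the complete axial gauge the plaquette field solves a FLAT div–curl system
# with small data; **the covariant curvature gradient of EVERY regular configuration on `ℤ^d` is `O((1 + log R)(b + R a² + a/R))`**

Helper file (`--supports stmt-QuantumFields-19200`, crux child «MinimiserStabilityRegPr» of rung R3's K1, cell `ym3-torus`, seat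
`ym3-torus-p1` gen 13; memo HOME/UV3-NODE.md §22).  Theorems only; no new definition.

THE THEOREM (`norm_covDeriv_plaqF_le`, `d ≥ 3`, `𝔸` a complete-free normed `ℂ`-algebra with `‖1‖ = 1`, configurations with values in
`U1 = {‖u‖ ≤ 1, ‖u⁻¹‖ ≤ 1}`): there is `C = C(d)` such that for `R ≥ 4` and every `V : ℤ^d → 𝔸ˣ` with
`‖V(∂p) − 1‖ ≤ a ≤ 1` (all plaquettes) and `‖(D^{1*}_V ∂V)(b)‖ ≤ b` (all bonds, [Balaban1985RegularSpaces] (1.2)),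
  `‖(D^{1*}_{V,ν} F_{κμ})(0)‖ ≤ C·(1 + log R)·(b + R·a² + a/R)`  for all `ν, κ, μ`.
NO criticality, NO constraint structure: regularity (8) alone.  With `a = B₃ε₁η²`, `b = B₃ε₁η³`, `R = η⁻¹ = L^{K−n}` this is
`O(B₃(1 + B₃)·ε₁η³·(1 + (K−n) log L))` — the log-Lipschitz bound of the reshaped stub V4′ (file 3/3 transfers it to the torus).

PROOF.  `W := V^{v₀}`, `v₀ = axialFn V 0` (complete axial gauge at `0`, tree `B7Prop1Explicit.axial_bond_bound`: `‖W(z,μ) − 1‖ ≤ |z|₁·a`);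
`M(z; κ, μ) := F^W_{κμ}(z) − 1` (all index pairs).  §1: one covariant difference of `W` differs from the flat one by `≤ 2‖W(b) − 1‖·a`;
§2: `‖M‖ ≤ a`, `‖div₂ M − D^{1*}_W∂W‖ ≤ d(2βa + 2a²)` (reversed orientations cost `a²`), `‖d₂ M‖ ≤ 60a² + 6βa` (file 1/3, lattice
Bianchi); §3: the flat 2-tensor estimate `…CurvGradFlatTensor.tensor_norm_sub_le` on the box `{|z_k| ≤ 4R}` (`β ≤ 4dR·a`) and gauge
invariance of the norms (tree `B8Ineq132.covDeriv_gaugeAct`, `norm_conjR`).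

References: T. Bałaban, CMP 99 (1985) 75–102 [Balaban1985RegularSpaces] (1.1), (1.2), (1.11); CMP 98 (1985) 17–51 [Balaban1985Averaging]
pp. 24–25 (axial gauge).  No sorry, standard axioms.  NOT a claim about the mass gap.
-/

set_option autoImplicit false

noncomputable section

open Finset
open Literature.MathematicalPhysics.QuantumFieldTheory.Balaban1983to89
open B7Prop1Explicit (Site Letter e hol plaqWord gaugeAct axialFn U1 mem_U1 hol_mem gaugeAct_mem axialFn_mem l1 l1_add_le l1_neg
  norm_inv_sub_one_le axial_bond_bound)
open B7Eq78Linearization (conjR conjR_apply conjR_sub conjR_one)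
open B8Ineq132 (plaqF covDeriv covDiv plaqF_gaugeAct covDeriv_gaugeAct norm_covDiv_gaugeAct norm_conjR)
open Literature.MathematicalPhysics.QuantumFieldTheory.LatticeForm (d₂)
open Literature.MathematicalPhysics.QuantumFieldTheory.LatticeChain (div₂)
open Summit.QuantumFields.YangMills.Theorems.CurvGradFlat (tensor_norm_sub_le)

namespace Summit.QuantumFields.YangMills.Theorems.CurvGradAxial

variable {d : ℕ} {𝔸 : Type*} [NormedRing 𝔸] [NormOneClass 𝔸] [NormedAlgebra ℂ 𝔸]

/-! ## §1 One covariant difference against the flat one; reversed and degenerate plaquettes -/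

omit [NormOneClass 𝔸] in
/-- The `η = 1` backward covariant difference spelled out. [cite: Balaban1985RegularSpaces, (1.1) p.76] -/
theorem covDeriv_one_eq (W : Site d → Fin d → 𝔸ˣ) (ν : Fin d) (F : Site d → 𝔸) (x : Site d) :
    covDeriv 1 W ν F x = conjR (W (x - e ν) ν)⁻¹ (F (x - e ν)) - F x := by
  unfold covDeriv; rw [inv_one, one_smul]

omit [NormedAlgebra ℂ 𝔸] in
/-- `‖R(w⁻¹)X − X‖ ≤ 2‖w − 1‖·‖X − 1‖` for `w ∈ U1` (`R(w⁻¹)1 = 1`, file 1/3 `norm_conj_sub_one_sub_le`). [folklore] -/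
theorem norm_conjR_inv_sub_le {w : 𝔸ˣ} (hw : w ∈ U1 𝔸) (X : 𝔸) :
    ‖conjR w⁻¹ X - X‖ ≤ 2 * ‖(w : 𝔸) - 1‖ * ‖X - 1‖ := by
  have h := norm_conj_sub_one_sub_le ((U1 𝔸).inv_mem hw) X
  rw [inv_inv] at h
  have e1 : conjR w⁻¹ X - X = ((w⁻¹ : 𝔸ˣ) : 𝔸) * X * (w : 𝔸) - 1 - (X - 1) := by rw [conjR_apply, inv_inv]; abel
  rw [e1]
  refine h.trans ?_
  have := norm_inv_sub_one_le hw
  have h0 : 0 ≤ ‖X - 1‖ := norm_nonneg _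
  nlinarith

omit [NormOneClass 𝔸] in
/-- **COVARIANT VERSUS FLAT DIFFERENCE**: `‖(D^{1*}_{W,ν}F)(x) − (F(x − e_ν) − F(x))‖ ≤ 2‖W(x−e_ν,x) − 1‖·‖F(x − e_ν) − 1‖`
(`W ∈ U1`). [cite: Balaban1985RegularSpaces, (1.1) p.76] -/
theorem norm_covDeriv_sub_flat_le [NormOneClass 𝔸] {W : Site d → Fin d → 𝔸ˣ} (hW : ∀ x κ, W x κ ∈ U1 𝔸) (ν : Fin d) (F : Site d → 𝔸)
    (x : Site d) : ‖covDeriv 1 W ν F x - (F (x - e ν) - F x)‖ ≤ 2 * ‖(W (x - e ν) ν : 𝔸) - 1‖ * ‖F (x - e ν) - 1‖ := by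
  rw [covDeriv_one_eq, show conjR (W (x - e ν) ν)⁻¹ (F (x - e ν)) - F x - (F (x - e ν) - F x) =
    conjR (W (x - e ν) ν)⁻¹ (F (x - e ν)) - F (x - e ν) by abel]
  exact norm_conjR_inv_sub_le (hW _ _) _

omit [NormOneClass 𝔸] [NormedAlgebra ℂ 𝔸] in
/-- The degenerate plaquette word `∂p_{κκ}` has trivial holonomy: `F_{κκ} = 1`. [folklore] -/
theorem plaqF_self (W : Site d → Fin d → 𝔸ˣ) (κ : Fin d) (y : Site d) : plaqF W κ κ y = 1 := by
  unfold plaqF; rw [hol_plaqWord_eq]; simp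

omit [NormOneClass 𝔸] [NormedAlgebra ℂ 𝔸] in
/-- The reversed plaquette is the inverse: `V(∂p_{μκ}) = V(∂p_{κμ})⁻¹`. [cite: Balaban1985Averaging, (9) p.18] -/
theorem hol_plaqWord_swap (W : Site d → Fin d → 𝔸ˣ) (κ μ : Fin d) (y : Site d) :
    hol W y (plaqWord μ κ) = (hol W y (plaqWord κ μ))⁻¹ := by
  rw [hol_plaqWord_eq, hol_plaqWord_eq]; group

omit [NormedAlgebra ℂ 𝔸] in
/-- Reversing the orientation costs `a²`: `‖(F_{μκ} − 1) + (F_{κμ} − 1)‖ ≤ ‖F_{κμ} − 1‖²` (`W ∈ U1`). [folklore] -/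
theorem norm_plaqF_swap_add_le {W : Site d → Fin d → 𝔸ˣ} (hW : ∀ x κ, W x κ ∈ U1 𝔸) (κ μ : Fin d) (y : Site d) :
    ‖(plaqF W μ κ y - 1) + (plaqF W κ μ y - 1)‖ ≤ ‖plaqF W κ μ y - 1‖ * ‖plaqF W κ μ y - 1‖ := by
  unfold plaqF; rw [hol_plaqWord_swap]; exact norm_inv_sub_one_add_le (hol_mem hW _ _)

/-! ## §2 The flat data of `M = F^W − 1`: divergence and coboundary -/

omit [NormOneClass 𝔸] in
/-- **DIVERGENCE**: for `W ∈ U1` with all plaquettes within `a ≤ 1` of `1` and the bonds `W(y − e_ν, y)` within `β` of `1`,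
`‖div₂(F^W − 1)(y; μ) − (D^{1*}_W ∂W)_μ(y)‖ ≤ d·(2βa + 2a²)` (reversed orientations `ν > μ` cost `a²` each).
[cite: Balaban1985RegularSpaces, (1.2) p.76] -/
theorem norm_div2_sub_covDiv_le [NormOneClass 𝔸] {W : Site d → Fin d → 𝔸ˣ} (hW : ∀ x κ, W x κ ∈ U1 𝔸) {a β : ℝ} (ha : 0 ≤ a)
    (hP : ∀ (y : Site d) (κ μ : Fin d), ‖plaqF W κ μ y - 1‖ ≤ a) (y : Site d) (hβ : ∀ ν, ‖(W (y - e ν) ν : 𝔸) - 1‖ ≤ β) (μ : Fin d) :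
    ‖div₂ (fun z κ' μ' => plaqF W κ' μ' z - 1) y μ - covDiv 1 W μ y‖ ≤ d * (2 * β * a + 2 * a ^ 2) := by
  have hβ0 : 0 ≤ β := (norm_nonneg _).trans (hβ μ)
  -- both sides as sums over all `ν`
  have hIio : ∑ ν ∈ Finset.Iio μ, covDeriv 1 W ν (plaqF W ν μ) y = ∑ ν, if ν < μ then covDeriv 1 W ν (plaqF W ν μ) y else 0 := by
    rw [← Finset.sum_filter]; congr 1; ext ν; simp
  have hIoi : ∑ ν ∈ Finset.Ioi μ, covDeriv 1 W ν (plaqF W μ ν) y = ∑ ν, if μ < ν then covDeriv 1 W ν (plaqF W μ ν) y else 0 := by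
    rw [← Finset.sum_filter]; congr 1; ext ν; simp
  have hcov : covDiv 1 W μ y = ∑ ν, ((if ν < μ then covDeriv 1 W ν (plaqF W ν μ) y else 0) -
      (if μ < ν then covDeriv 1 W ν (plaqF W μ ν) y else 0)) := by
    unfold covDiv; rw [hIio, hIoi, Finset.sum_sub_distrib]
  have hdiv : div₂ (fun z κ' μ' => plaqF W κ' μ' z - 1) y μ = ∑ ν, ((plaqF W ν μ (y - e ν) - 1) - (plaqF W ν μ y - 1)) := rfl
  rw [hcov, hdiv, ← Finset.sum_sub_distrib]
  -- termwise
  have hterm : ∀ ν, ‖(plaqF W ν μ (y - e ν) - 1) - (plaqF W ν μ y - 1) - ((if ν < μ then covDeriv 1 W ν (plaqF W ν μ) y else 0) -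
      (if μ < ν then covDeriv 1 W ν (plaqF W μ ν) y else 0))‖ ≤ 2 * β * a + 2 * a ^ 2 := by
    intro ν
    rcases lt_trichotomy ν μ with hlt | heq | hgt
    · rw [if_pos hlt, if_neg (not_lt.2 hlt.le), sub_zero]
      have h := norm_covDeriv_sub_flat_le hW ν (plaqF W ν μ) y
      rw [show (plaqF W ν μ (y - e ν) - 1) - (plaqF W ν μ y - 1) - covDeriv 1 W ν (plaqF W ν μ) y =
        -(covDeriv 1 W ν (plaqF W ν μ) y - (plaqF W ν μ (y - e ν) - plaqF W ν μ y)) by abel, norm_neg]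
      refine h.trans ?_
      have := mul_le_mul (mul_le_mul_of_nonneg_left (hβ ν) zero_le_two) (hP (y - e ν) ν μ) (norm_nonneg _) (by positivity)
      nlinarith
    · subst heq
      have h0 : (0 : ℝ) ≤ 2 * β * a + 2 * a ^ 2 := by positivity
      simpa [plaqF_self] using h0
    · rw [if_neg (not_lt.2 hgt.le), if_pos hgt, zero_sub, sub_neg_eq_add]
      -- reversed orientation: `F_{νμ} − 1 = −(F_{μν} − 1) + Q`, `‖Q‖ ≤ a²`
      have hQ1 := norm_plaqF_swap_add_le hW μ ν (y - e ν)
      have hQ2 := norm_plaqF_swap_add_le hW μ ν y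
      have h := norm_covDeriv_sub_flat_le hW ν (plaqF W μ ν) y
      have e1 : (plaqF W ν μ (y - e ν) - 1) - (plaqF W ν μ y - 1) + covDeriv 1 W ν (plaqF W μ ν) y =
          ((plaqF W ν μ (y - e ν) - 1) + (plaqF W μ ν (y - e ν) - 1)) - ((plaqF W ν μ y - 1) + (plaqF W μ ν y - 1)) +
            (covDeriv 1 W ν (plaqF W μ ν) y - (plaqF W μ ν (y - e ν) - plaqF W μ ν y)) := by abel
      rw [e1]
      refine (norm_add_le _ _).trans ((add_le_add ((norm_sub_le _ _).trans (add_le_add hQ1 hQ2)) h).trans ?_)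
      have h1 := hP (y - e ν) μ ν; have h2 := hP y μ ν
      have h3 : ‖plaqF W μ ν (y - e ν) - 1‖ * ‖plaqF W μ ν (y - e ν) - 1‖ ≤ a * a := mul_le_mul h1 h1 (norm_nonneg _) ha
      have h4 : ‖plaqF W μ ν y - 1‖ * ‖plaqF W μ ν y - 1‖ ≤ a * a := mul_le_mul h2 h2 (norm_nonneg _) ha
      have h5 : 2 * ‖(W (y - e ν) ν : 𝔸) - 1‖ * ‖plaqF W μ ν (y - e ν) - 1‖ ≤ 2 * β * a :=
        mul_le_mul (mul_le_mul_of_nonneg_left (hβ ν) zero_le_two) h1 (norm_nonneg _) (by positivity)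
      nlinarith
  calc _ ≤ ∑ ν : Fin d, ‖(plaqF W ν μ (y - e ν) - 1) - (plaqF W ν μ y - 1) - ((if ν < μ then covDeriv 1 W ν (plaqF W ν μ) y else 0) -
        (if μ < ν then covDeriv 1 W ν (plaqF W μ ν) y else 0))‖ := norm_sum_le _ _
    _ ≤ ∑ _ν : Fin d, (2 * β * a + 2 * a ^ 2) := Finset.sum_le_sum fun ν _ => hterm ν
    _ = d * (2 * β * a + 2 * a ^ 2) := by rw [Finset.sum_const, Finset.card_univ, Fintype.card_fin, nsmul_eq_mul]

omit [NormedAlgebra ℂ 𝔸] in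
/-- **COBOUNDARY**: under the same hypotheses, with the three bonds `W(y, y + e_μ)` within `β` of `1`, every component of the flat
coboundary is small: `‖d₂(F^W − 1)(y; i, j, k)‖ ≤ 60a² + 6βa` (pairwise distinct: the lattice Bianchi identity, file 1/3; coincident
indices: `0` or a reversed pair `≤ 2a²`). [folklore] -/
theorem norm_d2_le {W : Site d → Fin d → 𝔸ˣ} (hW : ∀ x κ, W x κ ∈ U1 𝔸) {a β : ℝ} (ha : 0 ≤ a) (ha1 : a ≤ 1) (hβ0 : 0 ≤ β)
    (hP : ∀ (y : Site d) (κ μ : Fin d), ‖plaqF W κ μ y - 1‖ ≤ a) (y : Site d) (hβ : ∀ μ, ‖(W y μ : 𝔸) - 1‖ ≤ β) (i j k : Fin d) :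
    ‖d₂ (fun z κ' μ' => plaqF W κ' μ' z - 1) y i j k‖ ≤ 60 * a ^ 2 + 6 * β * a := by
  have hd2 : d₂ (fun z κ' μ' => plaqF W κ' μ' z - 1) y i j k = (plaqF W j k (y + e i) - 1 - (plaqF W j k y - 1)) -
      (plaqF W i k (y + e j) - 1 - (plaqF W i k y - 1)) + (plaqF W i j (y + e k) - 1 - (plaqF W i j y - 1)) := rfl
  rw [hd2]
  have hpos : 0 ≤ 60 * a ^ 2 + 6 * β * a := by positivity
  by_cases hij : i = j
  · subst hij
    simpa [plaqF_self] using hpos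
  by_cases hjk : j = k
  · subst hjk
    rw [plaqF_self, plaqF_self]; simp only [sub_self, zero_sub]
    rw [show -( plaqF W i j (y + e j) - 1 - (plaqF W i j y - 1)) + (plaqF W i j (y + e j) - 1 - (plaqF W i j y - 1)) = 0 by abel,
      norm_zero]; exact hpos
  by_cases hik : i = k
  · subst hik
    rw [plaqF_self, plaqF_self, sub_self, sub_zero]
    have hQ1 := norm_plaqF_swap_add_le hW i j (y + e i)
    have hQ2 := norm_plaqF_swap_add_le hW i j y
    rw [show plaqF W j i (y + e i) - 1 - (plaqF W j i y - 1) + (plaqF W i j (y + e i) - 1 - (plaqF W i j y - 1)) =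
      ((plaqF W j i (y + e i) - 1) + (plaqF W i j (y + e i) - 1)) - ((plaqF W j i y - 1) + (plaqF W i j y - 1)) by abel]
    refine (norm_sub_le _ _).trans ((add_le_add hQ1 hQ2).trans ?_)
    have h1 := hP (y + e i) i j; have h2 := hP y i j
    have h3 := mul_le_mul h1 h1 (norm_nonneg _) ha; have h4 := mul_le_mul h2 h2 (norm_nonneg _) ha
    nlinarith
  -- pairwise distinct: lattice Bianchi
  have h := norm_d2_plaqF_le W hW ha ha1 hβ0 (fun z κ μ _ => hP z κ μ) y hβ hij hik hjk
  rw [show plaqF W j k (y + e i) - 1 - (plaqF W j k y - 1) - (plaqF W i k (y + e j) - 1 - (plaqF W i k y - 1)) +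
      (plaqF W i j (y + e k) - 1 - (plaqF W i j y - 1)) = (plaqF W j k (y + e i) - plaqF W j k y) -
      (plaqF W i k (y + e j) - plaqF W i k y) + (plaqF W i j (y + e k) - plaqF W i j y) by abel]
  exact h


/-! ## §3 The curvature gradient of a regular configuration on `ℤ^d` -/

omit [NormOneClass 𝔸] [NormedAlgebra ℂ 𝔸] in
/-- `|z|₁ ≤ d·h` on the sup-box `{|z_k| ≤ h}`. [folklore] -/
theorem l1_le_of_box {h : ℕ} {z : Site d} (hz : ∀ k, |z k| ≤ (h : ℤ)) : (l1 z : ℝ) ≤ d * h := by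
  have h1 : l1 z ≤ d * h := B10Eq27AxialLog.l1_le_mul_of_natAbs_le fun κ => by
    have := hz κ; rw [Int.abs_eq_natAbs] at this; exact_mod_cast this
  exact_mod_cast h1

omit [NormOneClass 𝔸] [NormedAlgebra ℂ 𝔸] in
/-- `|e_ν|₁ = 1`. [folklore] -/
theorem l1_e (ν : Fin d) : l1 (e ν : Site d) = 1 := by
  rw [← B7Prop1Explicit.Letter.vec_true]; exact B7Prop1Explicit.l1_vec _

/-- **THE CURVATURE GRADIENT OF A REGULAR CONFIGURATION** (`d ≥ 3`): there is `C > 0` such that for `R ≥ 4`, every `U1`-valued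
configuration `V` on `ℤ^d` with `‖V(∂p) − 1‖ ≤ a ≤ 1` for all plaquettes and `‖(D^{1*}_V ∂V)_μ(y)‖ ≤ b` for all bonds satisfies, for
all `ν, κ, μ`, `‖(D^{1*}_{V,ν}F_{κμ})(0)‖ ≤ C·(1 + log R)·(b + R·a² + a/R)`.  (Base point `0`; any base point by translation.)
The constant: `C = C₀(d+2)·96d² + 2`, `C₀` the flat 2-tensor constant. [cite: Balaban1985RegularSpaces, (1.1)-(1.2) p.76, (1.9) p.77] -/
theorem norm_covDeriv_plaqF_le (hd : 3 ≤ d) : ∃ C : ℝ, 0 < C ∧ ∀ (R : ℕ), 4 ≤ R →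
    ∀ (V : Site d → Fin d → 𝔸ˣ), (∀ x κ, V x κ ∈ U1 𝔸) → ∀ (a b : ℝ), 0 ≤ a → a ≤ 1 →
    (∀ (y : Site d) (κ μ : Fin d), κ ≠ μ → ‖plaqF V κ μ y - 1‖ ≤ a) →
    (∀ (y : Site d) (μ : Fin d), ‖covDiv 1 V μ y‖ ≤ b) →
    ∀ ν κ μ : Fin d, ‖covDeriv 1 V ν (plaqF V κ μ) 0‖ ≤ C * (1 + Real.log R) * (b + R * a ^ 2 + a / R) := by
  obtain ⟨C₀, hC₀, hT⟩ := tensor_norm_sub_le (d := d) (E := 𝔸) hd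
  refine ⟨C₀ * ((d + 2) * (96 * d ^ 2)) + 2, by positivity, fun R hR V hV a b ha ha1 hP hdiv ν κ μ => ?_⟩
  have hR1 : (1 : ℝ) ≤ R := by exact_mod_cast (show 1 ≤ R by omega)
  have hR4 : (4 : ℝ) ≤ R := by exact_mod_cast hR
  have hd3 : (3 : ℝ) ≤ d := by exact_mod_cast hd
  have hlog : 0 ≤ Real.log R := Real.log_nonneg hR1
  have hb0 : 0 ≤ b := (norm_nonneg _).trans (hdiv 0 ν)
  -- the complete axial gauge at `0`
  set u : Site d → 𝔸ˣ := axialFn V 0 with hu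
  set W : Site d → Fin d → 𝔸ˣ := gaugeAct u V with hW
  have hum : ∀ x, u x ∈ U1 𝔸 := fun x => axialFn_mem hV 0 x
  have hWm : ∀ x κ, W x κ ∈ U1 𝔸 := gaugeAct_mem hV hum
  have hWb : ∀ (x : Site d) (μ : Fin d), ‖(W x μ : 𝔸) - 1‖ ≤ l1 x * a := fun x μ => by
    have h := axial_bond_bound V hV 0 (fun z κ μ hne => hP z κ μ hne) ha x μ
    rwa [sub_zero] at h
  have hWP : ∀ (y : Site d) (κ μ : Fin d), ‖plaqF W κ μ y - 1‖ ≤ a := by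
    intro y κ μ
    by_cases hκμ : κ = μ
    · subst hκμ; rw [plaqF_self, sub_self, norm_zero]; exact ha
    · have e1 : plaqF W κ μ y - 1 = conjR (u y) (plaqF V κ μ y - 1) := by rw [conjR_sub, conjR_one, hW, plaqF_gaugeAct]
      rw [e1, norm_conjR (hum y)]; exact hP y κ μ hκμ
  have hWdiv : ∀ (y : Site d) (μ : Fin d), ‖covDiv 1 W μ y‖ ≤ b := fun y μ => by
    rw [hW, norm_covDiv_gaugeAct 1 hum]; exact hdiv y μ
  -- the flat 2-tensor and its data on the box `{|z_k| ≤ 4R}`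
  set M : Site d → Fin d → Fin d → 𝔸 := fun z κ' μ' => plaqF W κ' μ' z - 1 with hM
  set M₁ : ℝ := b + d * (2 * ((4 * d * R + 1) * a) * a + 2 * a ^ 2) with hM₁
  set M₂ : ℝ := 60 * a ^ 2 + 6 * (4 * d * R * a) * a with hM₂
  have hbox : ∀ z : Site d, (∀ k, |z k| ≤ 4 * (R : ℤ)) → (l1 z : ℝ) ≤ 4 * d * R := fun z hz => by
    have := l1_le_of_box (d := d) (h := 4 * R) (z := z) (fun k => by push_cast; exact hz k); push_cast at this; linarith
  have hM0' : ∀ z : Site d, (∀ k, |z k| ≤ 4 * (R : ℤ)) → ∀ κ' μ', ‖M z κ' μ'‖ ≤ a := fun z _ κ' μ' => hWP z κ' μ'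
  have hM1' : ∀ z : Site d, (∀ k, |z k| ≤ 4 * (R : ℤ)) → ∀ μ', ‖div₂ M z μ'‖ ≤ M₁ := by
    intro z hz μ'
    have hβ : ∀ ν', ‖(W (z - e ν') ν' : 𝔸) - 1‖ ≤ (4 * d * R + 1) * a := fun ν' => by
      refine (hWb _ _).trans (mul_le_mul_of_nonneg_right ?_ ha)
      have h1 : (l1 (z - e ν') : ℝ) ≤ l1 z + l1 (-e ν' : Site d) := by
        rw [sub_eq_add_neg]; exact_mod_cast l1_add_le z (-e ν')
      rw [l1_neg, l1_e] at h1; push_cast at h1; linarith [hbox z hz]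
    have h := norm_div2_sub_covDiv_le hWm ha hWP z hβ μ'
    rw [← hM] at h
    have h2 : ‖div₂ M z μ'‖ ≤ ‖div₂ M z μ' - covDiv 1 W μ' z‖ + ‖covDiv 1 W μ' z‖ := norm_le_norm_sub_add _ _
    rw [hM₁]; linarith [hWdiv z μ']
  have hM2' : ∀ z : Site d, (∀ k, |z k| ≤ 4 * (R : ℤ)) → ∀ i j k, ‖d₂ M z i j k‖ ≤ M₂ := by
    intro z hz i j k
    have hβ : ∀ μ', ‖(W z μ' : 𝔸) - 1‖ ≤ 4 * d * R * a := fun μ' => (hWb z μ').trans (mul_le_mul_of_nonneg_right (hbox z hz) ha)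
    exact norm_d2_le hWm ha ha1 (by positivity) hWP z hβ i j k
  -- the flat estimate
  have hflat := (hT R hR M a M₁ M₂ hM0' hM1' hM2' ν κ μ).2
  -- gauge invariance and the flat-versus-covariant error at the bond `⟨−e_ν, 0⟩`
  have hcov : ‖covDeriv 1 V ν (plaqF V κ μ) 0‖ = ‖covDeriv 1 W ν (plaqF W κ μ) 0‖ := by
    rw [hW, covDeriv_gaugeAct 1 u V ν (F := plaqF V κ μ) (Fu := plaqF (gaugeAct u V) κ μ) (fun z => plaqF_gaugeAct u V κ μ z) 0,
      norm_conjR (hum 0)]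
  have herr : ‖covDeriv 1 W ν (plaqF W κ μ) 0 - (M (-e ν) κ μ - M 0 κ μ)‖ ≤ 2 * a ^ 2 := by
    have h := norm_covDeriv_sub_flat_le hWm ν (plaqF W κ μ) 0
    rw [zero_sub] at h
    have e1 : M (-e ν) κ μ - M 0 κ μ = plaqF W κ μ (-e ν) - plaqF W κ μ 0 := by simp only [hM]; abel
    rw [e1]
    refine h.trans ?_
    have h1 : ‖(W (-e ν) ν : 𝔸) - 1‖ ≤ a := by have := hWb (-e ν) ν; rw [l1_neg, l1_e, Nat.cast_one, one_mul] at this; exact this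
    have h2 := hWP (-e ν) κ μ
    nlinarith [norm_nonneg ((W (-e ν) ν : 𝔸) - 1), norm_nonneg (plaqF W κ μ (-e ν) - 1)]
  -- assemble
  rw [hcov]
  have hsplit : ‖covDeriv 1 W ν (plaqF W κ μ) 0‖ ≤ ‖M (-e ν) κ μ - M 0 κ μ‖ + 2 * a ^ 2 := by
    have := norm_le_norm_sub_add (covDeriv 1 W ν (plaqF W κ μ) 0) (M (-e ν) κ μ - M 0 κ μ)
    linarith [norm_sub_rev (covDeriv 1 W ν (plaqF W κ μ) 0) (M (-e ν) κ μ - M 0 κ μ)]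
  refine hsplit.trans ?_
  have hflat' : ‖M (-e ν) κ μ - M 0 κ μ‖ ≤ C₀ * (1 + Real.log R) * ((d + 2) * (M₁ + M₂) + a / R) := hflat
  -- `(d+2)(M₁+M₂) + a/R ≤ (d+2)·96d²·(b + R a² + a/R)`
  have hMM : M₁ + M₂ ≤ b + 96 * d ^ 2 * R * a ^ 2 := by
    have e1 : M₁ + M₂ = b + (8 * d ^ 2 * R + 4 * d + 60 + 24 * d * R) * a ^ 2 := by rw [hM₁, hM₂]; ring
    have hc : 8 * (d : ℝ) ^ 2 * R + 4 * d + 60 + 24 * d * R ≤ 96 * d ^ 2 * R := by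
      have h1 : (12 : ℝ) ≤ d * R := by nlinarith
      have h2 : (3 : ℝ) * (d * R) ≤ d ^ 2 * R := by nlinarith
      nlinarith [h1, h2]
    rw [e1]
    have := mul_le_mul_of_nonneg_right hc (sq_nonneg a)
    linarith
  have hK : (d + 2) * (M₁ + M₂) + a / R ≤ (d + 2) * (96 * d ^ 2) * (b + R * a ^ 2 + a / R) := by
    have h96 : (1 : ℝ) ≤ 96 * d ^ 2 := by nlinarith
    have haR : 0 ≤ a / R := by positivity
    have h1 : (d + 2) * (M₁ + M₂) ≤ (d + 2) * (96 * d ^ 2) * (b + R * a ^ 2) := by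
      calc (d + 2) * (M₁ + M₂) ≤ (d + 2) * (b + 96 * d ^ 2 * R * a ^ 2) := mul_le_mul_of_nonneg_left hMM (by positivity)
        _ ≤ (d + 2) * (96 * d ^ 2 * (b + R * a ^ 2)) := by
            refine mul_le_mul_of_nonneg_left ?_ (by positivity)
            have hb1 : 1 * b ≤ 96 * d ^ 2 * b := mul_le_mul_of_nonneg_right h96 hb0
            have e2 : 96 * (d : ℝ) ^ 2 * (b + R * a ^ 2) = 96 * d ^ 2 * b + 96 * d ^ 2 * R * a ^ 2 := by ring
            rw [e2]; linarith
        _ = (d + 2) * (96 * d ^ 2) * (b + R * a ^ 2) := by ring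
    have h2 : a / R ≤ (d + 2) * (96 * d ^ 2) * (a / R) := by
      have : (1 : ℝ) ≤ (d + 2) * (96 * d ^ 2) := by nlinarith
      exact le_mul_of_one_le_left haR this
    have e3 : ((d : ℝ) + 2) * (96 * d ^ 2) * (b + R * a ^ 2 + a / R) =
        (d + 2) * (96 * d ^ 2) * (b + R * a ^ 2) + (d + 2) * (96 * d ^ 2) * (a / R) := by ring
    rw [e3]; linarith [h1, h2]
  have h2a : 2 * a ^ 2 ≤ 2 * ((1 + Real.log R) * (b + R * a ^ 2 + a / R)) := by
    have h1 : a ^ 2 ≤ R * a ^ 2 := le_mul_of_one_le_left (sq_nonneg a) hR1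
    have h0 : 0 ≤ a / R := by positivity
    have h2 : b + R * a ^ 2 + a / R ≤ (1 + Real.log R) * (b + R * a ^ 2 + a / R) :=
      le_mul_of_one_le_left (by positivity) (by linarith)
    linarith
  calc ‖M (-e ν) κ μ - M 0 κ μ‖ + 2 * a ^ 2
      ≤ C₀ * (1 + Real.log R) * ((d + 2) * (96 * d ^ 2) * (b + R * a ^ 2 + a / R)) + 2 * ((1 + Real.log R) * (b + R * a ^ 2 + a / R)) :=
        add_le_add (hflat'.trans (mul_le_mul_of_nonneg_left hK (by positivity))) h2a
    _ = (C₀ * ((d + 2) * (96 * d ^ 2)) + 2) * (1 + Real.log R) * (b + R * a ^ 2 + a / R) := by ring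

end Summit.QuantumFields.YangMills.Theorems.CurvGradAxial

end
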